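import Summits.NavierStokesRegularity.NavierStokesRegularity.Theorems.TypeILiouvilleTypeIliouvilleNoTypeIIASlabModL
import Summits.NavierStokesRegularity.NavierStokesRegularity.Theorems.HodographBetchovFastClassSqueezeOfBounded
import HarnessLib

/-!
# The REGULAR case of the clause ASlab: a solution that extends past `T` has bounded scaled local
# kinetic energy on a final slab (crux `TypeIliouvilleNoTypeII`, stmt-NavierStokesRegularity-0056;
# door calculus `hreg` for ASlab)

Helper file (theorems only).  The door calculus for a Type-II-exclusion clause `D`
(`Theorems/TypeILiouvilleTypeIliouvilleNoTypeIIDoorCalculus.lean`, ns-typeII-p1) asks for three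
obligations: KILL (`D ⇒ Type-I rate` on maximal solutions), NECESSARY (`Type-I rate ⇒ D`) and REGULAR
(`D` holds for solutions that continue past `T`).  For the clause **ASlab** — «the viscosity-normalised
field `ũ = timeRescale ν⁻¹ ν⁻¹ u` has `A_ess(ũ; Q) ≤ I ≠ ∞` on every parabolic ball `Q` of a final
slab `(S₁, νT) × ℝ³`» — KILL holds MODULO (L) (`isTypeIBlowup_of_cknAEssSlab_of_liouvilleL`, file
`…ASlabModL.lean`) and NECESSARY is Albritton–Barker's Lemma 2.5 globalised (ns-typeII-p1, announced).
This file proves REGULAR, unconditionally: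

* `inv_mul_setLIntegral_ball_le_of_norm_le` — a field bounded by `L` has
  `r⁻¹ ∫_{B_r} ‖f‖² ≤ r² L² |B₁|` (small balls);
* `lintegral_enorm_sq_timeRescale_le` — the normalised slices have energy `≤ ν⁻² · 2E(u₀)` (large
  balls, Leray–Hopf energy inequality);
* `cknAEssSlab_of_hasSmoothExtensionPast` — **REGULAR for ASlab**: a classical Leray–Hopf solution on
  `[0, T)` from a rapidly decaying datum that extends classically past `T` is bounded on `[0,T) × ℝ³`
  (`FastClassSqueeze.bounded_of_hasSmoothExtensionPast`: Fatou at `t = T` + Tao's persistence of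
  regularity), hence satisfies ASlab with `S₁ = 0` and `I = (M/ν)² |B₁| + ν⁻² · 2E(u₀)`.

WHAT THIS IS NOT: not NS; nothing here bears on whether ASlab holds for BLOW-UPS (the open content).
-/

noncomputable section

-- the summit and its single problem share the name `NavierStokesRegularity` (D-0017 nested layout)
set_option linter.dupNamespace false

open Set Function Filter Topology MeasureTheory Metric
open scoped NNReal ENNReal

namespace Summit.NavierStokesRegularity.NavierStokesRegularity.Theorems.TypeIliouvilleNoTypeII.TypeIIZoom

open Literature.Analysis Literature.Analysis.FluidPDE
open Summit.NavierStokesRegularity.NavierStokesRegularity.Theorems.FastClassSqueeze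
  (bounded_of_hasSmoothExtensionPast)

/-! ## Two slice bounds -/

/-- **Small balls**: a field bounded by `L ≥ 0` has `r⁻¹ ∫_{B_r(x₀)} ‖f‖² ≤ r² · (L² |B₁|)`. [folklore] -/
theorem inv_mul_setLIntegral_ball_le_of_norm_le
    {f : EuclideanSpace ℝ (Fin 3) → EuclideanSpace ℝ (Fin 3)} {L : ℝ} (hf : ∀ x, ‖f x‖ ≤ L)
    {r : ℝ} (hr : 0 < r) (x₀ : EuclideanSpace ℝ (Fin 3)) :
    (ENNReal.ofReal r)⁻¹ * ∫⁻ x in ball x₀ r, ‖f x‖ₑ ^ 2 ≤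
      ENNReal.ofReal (r ^ 2) *
        (ENNReal.ofReal (L ^ 2) * volume (ball (0 : EuclideanSpace ℝ (Fin 3)) 1)) := by
  have hpt : ∀ x, ‖f x‖ₑ ^ 2 ≤ ENNReal.ofReal (L ^ 2) := fun x => by
    rw [← ofReal_norm, ← ENNReal.ofReal_pow (norm_nonneg _)]
    exact ENNReal.ofReal_le_ofReal (pow_le_pow_left₀ (norm_nonneg _) (hf x) 2)
  have h1 : ∫⁻ x in ball x₀ r, ‖f x‖ₑ ^ 2 ≤
      ENNReal.ofReal (L ^ 2) * volume (ball x₀ r) := by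
    calc ∫⁻ x in ball x₀ r, ‖f x‖ₑ ^ 2 ≤ ∫⁻ _ in ball x₀ r, ENNReal.ofReal (L ^ 2) :=
          lintegral_mono fun x => hpt x
      _ = ENNReal.ofReal (L ^ 2) * volume (ball x₀ r) := setLIntegral_const _ _
  rw [Measure.addHaar_ball_of_pos volume x₀ hr, finrank_euclideanSpace_fin] at h1
  calc (ENNReal.ofReal r)⁻¹ * ∫⁻ x in ball x₀ r, ‖f x‖ₑ ^ 2
      ≤ (ENNReal.ofReal r)⁻¹ * (ENNReal.ofReal (L ^ 2) *
          (ENNReal.ofReal (r ^ 3) * volume (ball (0 : EuclideanSpace ℝ (Fin 3)) 1))) :=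
        mul_le_mul' le_rfl h1
    _ = (ENNReal.ofReal r)⁻¹ * ENNReal.ofReal (r ^ 3) *
          (ENNReal.ofReal (L ^ 2) * volume (ball (0 : EuclideanSpace ℝ (Fin 3)) 1)) := by ring
    _ = ENNReal.ofReal (r ^ 2) *
          (ENNReal.ofReal (L ^ 2) * volume (ball (0 : EuclideanSpace ℝ (Fin 3)) 1)) := by
        rw [inv_ofReal_mul_ofReal_pow_three hr]

/-- **Large balls**: the slices of the normalised field `ũ = timeRescale ν⁻¹ ν⁻¹ u` of a
Leray–Hopf solution have energy `∫ ‖ũ(s)‖² = ν⁻² ∫ ‖u(s/ν)‖² ≤ ν⁻² · 2E(u₀)` for `s/ν ∈ [0, T]`.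
[cite: Leray1934, (5.2)] -/
theorem lintegral_enorm_sq_timeRescale_le {ν T : ℝ} (hν : 0 < ν)
    {u : ℝ → EuclideanSpace ℝ (Fin 3) → EuclideanSpace ℝ (Fin 3)}
    (hLH : IsLerayHopfOn T ν 0 (u 0) u) {s : ℝ} (hs : ν⁻¹ * s ∈ Icc 0 T) :
    ∫⁻ x, ‖timeRescale ν⁻¹ ν⁻¹ u s x‖ₑ ^ 2 ≤
      ENNReal.ofReal (ν⁻¹ ^ 2) * ENNReal.ofReal (2 * VectorCalculus.kineticEnergy (u 0)) := by
  have hν' : 0 ≤ ν⁻¹ := inv_nonneg.2 hν.le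
  have e : (fun x => ‖timeRescale ν⁻¹ ν⁻¹ u s x‖ₑ ^ 2) =
      fun x => ENNReal.ofReal (ν⁻¹ ^ 2) * ‖u (ν⁻¹ * s) x‖ₑ ^ 2 := by
    funext x
    rw [timeRescale_apply, enorm_smul, mul_pow, Real.enorm_eq_ofReal hν', ENNReal.ofReal_pow hν']
  rw [e, lintegral_const_mul' _ _ ENNReal.ofReal_ne_top]
  exact mul_le_mul' le_rfl (hLH.lintegral_enorm_sq_le hν.le hs)

/-! ## REGULAR for ASlab -/

/-- **A solution that extends past `T` satisfies the `A`-slab bound** (door-calculus REGULAR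
obligation for the clause ASlab).  Let `(u, p)` be classical on `[0, T)`, Leray–Hopf from a rapidly
decaying datum, and extend classically past `T`.  Then `u` is bounded by some `M` on `[0,T) × ℝ³`
(`FastClassSqueeze.bounded_of_hasSmoothExtensionPast`), so for the normalised field `ũ` and every
parabolic ball `Q_r(z) ⊆ (0, νT) × ℝ³`: `A_ess(ũ; Q_r(z)) ≤ (M/ν)² |B₁| + ν⁻² · 2E(u₀)` (balls of
radius `≤ 1` by the sup bound, `≥ 1` by the energy). [cite: Tao2011, Cor. 11.1 + Cor. 4.3 + Thm. 5.4 (iv)] -/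
theorem cknAEssSlab_of_hasSmoothExtensionPast {ν T : ℝ} (hν : 0 < ν) (hT : 0 < T)
    {u : ℝ → EuclideanSpace ℝ (Fin 3) → EuclideanSpace ℝ (Fin 3)}
    {p : ℝ → EuclideanSpace ℝ (Fin 3) → ℝ} (hsol : IsClassicalNSSolutionOn (Ico 0 T) ν 0 u p)
    (hLH : IsLerayHopfOn T ν 0 (u 0) u) (hdec : HasRapidSpatialDecay (u 0))
    (hext : HasSmoothExtensionPast ν 0 u T) :
    ∃ S₁ : ℝ, S₁ < ν * T ∧ ∃ I : ℝ≥0∞, I ≠ ⊤ ∧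
      ∀ r : ℝ, 0 < r → ∀ z : ℝ × EuclideanSpace ℝ (Fin 3),
        parabolicCylinder r z ⊆ Ioo S₁ (ν * T) ×ˢ univ →
        cknAEss r z (timeRescale ν⁻¹ ν⁻¹ u) ≤ I := by
  obtain ⟨M, hM⟩ := bounded_of_hasSmoothExtensionPast ν T hν hT u p hsol hLH hdec hext
  set E₀ : ℝ≥0∞ := ENNReal.ofReal (2 * VectorCalculus.kineticEnergy (u 0)) with hE₀
  set I : ℝ≥0∞ := ENNReal.ofReal ((ν⁻¹ * M) ^ 2) * volume (ball (0 : EuclideanSpace ℝ (Fin 3)) 1) +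
    ENNReal.ofReal (ν⁻¹ ^ 2) * E₀ with hI
  have hItop : I ≠ ⊤ :=
    ENNReal.add_ne_top.2 ⟨ENNReal.mul_ne_top ENNReal.ofReal_ne_top measure_ball_lt_top.ne,
      ENNReal.mul_ne_top ENNReal.ofReal_ne_top ENNReal.ofReal_ne_top⟩
  refine ⟨0, by positivity, I, hItop, fun r hr z hQ => ?_⟩
  unfold cknAEss
  refine essSup_le_of_ae_le _ (ae_restrict_of_forall_mem measurableSet_Ioo fun t ht => ?_)
  -- the time `t` of the slice lies in `(0, νT)`, so `t/ν ∈ [0, T)`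
  have hmem : (t, z.2) ∈ parabolicCylinder r z := by
    rw [mem_parabolicCylinder]
    exact ⟨ht, by simpa using hr⟩
  have htS : t ∈ Ioo 0 (ν * T) := (hQ hmem).1
  have hτ : ν⁻¹ * t ∈ Ico 0 T := by
    refine ⟨mul_nonneg (inv_nonneg.2 hν.le) htS.1.le, ?_⟩
    rw [inv_mul_lt_iff₀ hν]
    exact htS.2
  -- pointwise bound of the normalised slice
  have hpt : ∀ x, ‖timeRescale ν⁻¹ ν⁻¹ u t x‖ ≤ ν⁻¹ * M := fun x => by
    rw [timeRescale_apply, norm_smul, Real.norm_eq_abs, abs_of_nonneg (inv_nonneg.2 hν.le)]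
    exact mul_le_mul_of_nonneg_left (hM _ hτ x) (inv_nonneg.2 hν.le)
  rcases le_or_gt r 1 with hr1 | hr1
  · -- small balls: the sup bound
    calc (ENNReal.ofReal r)⁻¹ * ∫⁻ x in ball z.2 r, ‖timeRescale ν⁻¹ ν⁻¹ u t x‖ₑ ^ 2
        ≤ ENNReal.ofReal (r ^ 2) * (ENNReal.ofReal ((ν⁻¹ * M) ^ 2) *
            volume (ball (0 : EuclideanSpace ℝ (Fin 3)) 1)) :=
          inv_mul_setLIntegral_ball_le_of_norm_le hpt hr z.2
      _ ≤ 1 * (ENNReal.ofReal ((ν⁻¹ * M) ^ 2) * volume (ball (0 : EuclideanSpace ℝ (Fin 3)) 1)) :=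
          mul_le_mul' (ENNReal.ofReal_le_one.2 (by nlinarith)) le_rfl
      _ ≤ I := by rw [one_mul, hI]; exact le_self_add
  · -- large balls: the energy
    calc (ENNReal.ofReal r)⁻¹ * ∫⁻ x in ball z.2 r, ‖timeRescale ν⁻¹ ν⁻¹ u t x‖ₑ ^ 2
        ≤ 1 * ∫⁻ x, ‖timeRescale ν⁻¹ ν⁻¹ u t x‖ₑ ^ 2 :=
          mul_le_mul' (ENNReal.inv_le_one.2 (ENNReal.one_le_ofReal.2 hr1.le))
            (setLIntegral_le_lintegral _ _)
      _ ≤ ENNReal.ofReal (ν⁻¹ ^ 2) * E₀ := by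
          rw [one_mul]
          exact lintegral_enorm_sq_timeRescale_le hν hLH ⟨hτ.1, hτ.2.le⟩
      _ ≤ I := by rw [hI]; exact le_add_self

end Summit.NavierStokesRegularity.NavierStokesRegularity.Theorems.TypeIliouvilleNoTypeII.TypeIIZoom

end
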